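import Literature.NumberTheory.LFunctions.YoshidaWindowGramEnclosure
import Literature.Analysis.SpecialFunctions.DigammaLogBound
import Summits.RiemannHypothesis.RiemannHypothesis.Theorems.WeilFormatCTrigammaEdgeBound
import HarnessLib

/-!
# Format C, design C∞: kernel envelope — the archimedean part of Yoshida's Gram matrix

Route context: Fourier–Galerkin / Schur-complement certificates of Weil positivity on a window ("format C";
cell memo `run/shared/lean/pub/rh-explicit/rh-explicit-weil-10/KERNEL-LEVER.md` §18; supporting
stmt-RiemannHypothesis-0098; seat rh-explicit-weil-10).

Second of three files on the envelope of `gramCoeff a` ((5.15)/(5.16)).  The archimedean coefficient: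

* `abs_im_digamma_quarter_le`: `|Im ψ(¼ + iy/2)| ≤ 2 + π/2` for EVERY real `y` (`|Im ψ(w)| ≤ |Im w|/‖w‖² + π/2`,
  `DigammaLogBound`, and `ψ(¼) ∈ ℝ`);
* `abs_archExpSumSin_le`, `abs_archExpSumDiag_le'`: the exponential sums are bounded by `e^{−a}/(1 − e^{−4a})`
  resp. `4e^{−a} + e^{−5a}/(1 − e^{−4a})` uniformly in the mode (geometric tails of `YoshidaWindowGramEnclosure`);
* `abs_archCoeff_le_of_ne`: `|ARCH(n,m)| ≤ (2 + π/2 + 2e^{−a}/(1 − e^{−4a}))/(π|n − m|)` (`n ≠ m`);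
* `abs_re_deriv_digamma_freq_le`: `|Re ψ′(¼ + iω_n/2)| ≤ 16 + a + ‖ψ′(¼)‖` (trigamma bound off `n = 0`);
* `exists_abs_reDigammaQuarter_freq_le`, `exists_abs_archCoeff_diag_le`: `|Re ψ(¼ + iω_n/2)|`, `|ARCH(n,n)|`
  `≤ C(a) + log(1 + |n|)` (`exists_norm_digamma_vertical_le` on `Re w = ¼`).

Elementary; standard axioms; no definitions; no RH claim.
-/

set_option autoImplicit false
-- `Summit.RiemannHypothesis.RiemannHypothesis.…` is the layout-mandated namespace (summit = problem name).
set_option linter.dupNamespace false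

noncomputable section

open Complex Finset
open scoped Real BigOperators ArithmeticFunction.vonMangoldt

namespace Summit.RiemannHypothesis.RiemannHypothesis.Theorems.WeilFormatC

open Literature.NumberTheory.LFunctions Literature.NumberTheory.LFunctions.Yoshida1992
open Literature.Analysis.SpecialFunctions Literature.Analysis.SpecialFunctions.Complex

variable {a : ℝ}

/-! ## The archimedean coefficient -/

/-- `ψ(¼)` is real. -/
theorem im_digamma_one_quarter : (Complex.digamma (1 / 4 : ℂ)).im = 0 := by
  have h := digamma_conj (1 / 4 : ℂ)
  have e : (starRingEnd ℂ) (1 / 4 : ℂ) = 1 / 4 := by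
    rw [show (1 / 4 : ℂ) = ((1 / 4 : ℝ) : ℂ) by push_cast; ring, Complex.conj_ofReal]
  rw [e] at h
  exact Complex.conj_eq_iff_im.1 h.symm

/-- **`|Im ψ(¼ + iy/2)| ≤ 2 + π/2` for every real `y`** (`|Im ψ(w)| ≤ |Im w|/‖w‖² + π/2` and `|Im w|/‖w‖² ≤ 2` on
`Re w = ¼`; `ψ(¼) ∈ ℝ`). -/
theorem abs_im_digamma_quarter_le (y : ℝ) :
    |(Complex.digamma (1 / 4 + (y : ℂ) / 2 * I)).im| ≤ 2 + π / 2 := by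
  rcases eq_or_ne y 0 with rfl | hy
  · have e : (1 / 4 + ((0 : ℝ) : ℂ) / 2 * I) = (1 / 4 : ℂ) := by push_cast; ring
    rw [e, im_digamma_one_quarter, abs_zero]
    positivity
  set w : ℂ := 1 / 4 + (y : ℂ) / 2 * I with hw
  have hre : w.re = 1 / 4 := by simp [hw]
  have him : w.im = y / 2 := by simp [hw]
  have h := abs_im_digamma_le (w := w) (by rw [hre]; norm_num) (by rw [him]; exact div_ne_zero hy two_ne_zero)
  have hn : ‖w‖ ^ 2 = 1 / 16 + (y / 2) ^ 2 := by
    rw [Complex.sq_norm, Complex.normSq_apply, hre, him]; ring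
  rw [hn, him] at h
  have h2 : |y / 2| / (1 / 16 + (y / 2) ^ 2) ≤ 2 := by
    rw [div_le_iff₀ (by positivity)]
    nlinarith [sq_nonneg (|y / 2| - 1 / 4), sq_abs (y / 2), abs_nonneg (y / 2)]
  linarith

/-- `|Im ψ(¼ + iω_n/2)| ≤ 2 + π/2` at every frequency. -/
theorem abs_im_digamma_freq_le (a : ℝ) (n : ℤ) :
    |(Complex.digamma (1 / 4 + ((freq a n : ℝ) : ℂ) / 2 * I)).im| ≤ 2 + π / 2 :=
  abs_im_digamma_quarter_le _

/-- **The off-diagonal exponential sum is bounded**: `|Σ_k e^{−2a l_k} ω_n/(l_k² + ω_n²)| ≤ e^{−a}/(1 − e^{−4a})`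
(`a > 0`; the geometric tail bound from `K = 0`). -/
theorem abs_archExpSumSin_le (ha : 0 < a) (n : ℤ) :
    |archExpSumSin a n| ≤ Real.exp (-a) / (1 - Real.exp (-(4 * a))) := by
  have h := abs_archExpSumSin_sub_sum_le ha n 0
  have e : Real.exp (-(a * (4 * ((0 : ℕ) : ℝ) + 1))) = Real.exp (-a) := by norm_num
  rw [Finset.sum_range_zero, sub_zero, e] at h
  exact h

/-- **The diagonal exponential sum is bounded**: `|Σ_k e^{−2a l_k}(l_k² − ω_n²)/(l_k² + ω_n²)²| ≤ 4e^{−a} + e^{−5a}/(1 − e^{−4a})`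
(`a > 0`; first term + geometric tail from `K = 1`). -/
theorem abs_archExpSumDiag_le' (ha : 0 < a) (n : ℤ) :
    |archExpSumDiag a n| ≤ 4 * Real.exp (-a) + Real.exp (-(5 * a)) / (1 - Real.exp (-(4 * a))) := by
  have h := abs_archExpSumDiag_sub_sum_le ha n (K := 1) le_rfl
  simp only [Finset.range_one, Finset.sum_singleton, Nat.cast_one, mul_one] at h
  have h0 := abs_diagTerm_le a n 0
  rw [pow_zero, mul_one] at h0
  have e : Real.exp (-(a * (4 + 1))) = Real.exp (-(5 * a)) := by ring_nf
  rw [e] at h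
  have := abs_sub_abs_le_abs_sub (archExpSumDiag a n) (diagTerm a n 0)
  linarith

/-- **Archimedean envelope off the diagonal**:
`|ARCH(n,m)| ≤ (2 + π/2 + 2e^{−a}/(1 − e^{−4a}))/(π|n − m|)` (`a > 0`, `n ≠ m`). -/
theorem abs_archCoeff_le_of_ne (ha : 0 < a) {n m : ℤ} (hnm : n ≠ m) :
    |archCoeff a n m| ≤ (2 + π / 2 + 2 * (Real.exp (-a) / (1 - Real.exp (-(4 * a))))) / π / |(n : ℝ) - m| := by
  have hgap : 0 < |(n : ℝ) - m| := by
    rw [abs_pos, sub_ne_zero]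
    exact_mod_cast hnm
  unfold archCoeff
  rw [if_neg hnm]
  set Y := fun k : ℤ ↦ (Complex.digamma (1 / 4 + ((freq a k : ℝ) : ℂ) / 2 * I)).im with hY
  have hYb : ∀ k, |Y k| ≤ 2 + π / 2 := fun k ↦ abs_im_digamma_freq_le a k
  have hSb : ∀ k, |archExpSumSin a k| ≤ Real.exp (-a) / (1 - Real.exp (-(4 * a))) := abs_archExpSumSin_le ha
  have hA : |(Y m / 2 - archExpSumSin a m) - (Y n / 2 - archExpSumSin a n)|
      ≤ 2 + π / 2 + 2 * (Real.exp (-a) / (1 - Real.exp (-(4 * a)))) := by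
    have h1 := abs_sub (Y m / 2 - archExpSumSin a m) (Y n / 2 - archExpSumSin a n)
    have h2 := abs_sub (Y m / 2) (archExpSumSin a m)
    have h3 := abs_sub (Y n / 2) (archExpSumSin a n)
    have h4 : |Y m / 2| = |Y m| / 2 := by rw [abs_div, abs_of_pos (by norm_num : (0 : ℝ) < 2)]
    have h5 : |Y n / 2| = |Y n| / 2 := by rw [abs_div, abs_of_pos (by norm_num : (0 : ℝ) < 2)]
    linarith [hYb m, hYb n, hSb m, hSb n]
  rw [abs_mul, abs_div, abs_neg, abs_neg_one_zpow, abs_mul, abs_of_pos Real.pi_pos]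
  rw [show |((n : ℝ) - m)| = |(n : ℝ) - m| from rfl]
  calc 1 / (π * |(n : ℝ) - m|) * |(Y m / 2 - archExpSumSin a m) - (Y n / 2 - archExpSumSin a n)|
      ≤ 1 / (π * |(n : ℝ) - m|) * (2 + π / 2 + 2 * (Real.exp (-a) / (1 - Real.exp (-(4 * a))))) :=
        mul_le_mul_of_nonneg_left hA (by positivity)
    _ = (2 + π / 2 + 2 * (Real.exp (-a) / (1 - Real.exp (-(4 * a))))) / π / |(n : ℝ) - m| := by
        rw [div_div]; ring

/-- `Re ψ′(¼ + iω_n/2)` is bounded over the frequencies: `≤ 16 + a` for `n ≠ 0` (`‖ψ′(w)‖ ≤ 1/‖w‖² + π/(2|Im w|)`),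
and the single value at `n = 0`. -/
theorem abs_re_deriv_digamma_freq_le (ha : 0 < a) (n : ℤ) :
    |(deriv Complex.digamma (1 / 4 + ((freq a n : ℝ) : ℂ) / 2 * I)).re|
      ≤ 16 + a + ‖deriv Complex.digamma (1 / 4 + ((freq a 0 : ℝ) : ℂ) / 2 * I)‖ := by
  have hT : 0 ≤ ‖deriv Complex.digamma (1 / 4 + ((freq a 0 : ℝ) : ℂ) / 2 * I)‖ := norm_nonneg _
  rcases eq_or_ne n 0 with rfl | hn
  · have := (Complex.abs_re_le_norm (deriv Complex.digamma (1 / 4 + ((freq a 0 : ℝ) : ℂ) / 2 * I)))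
    linarith
  set w : ℂ := 1 / 4 + ((freq a n : ℝ) : ℂ) / 2 * I with hw
  have hre : w.re = 1 / 4 := by simp [hw]
  have him : w.im = freq a n / 2 := by simp [hw]
  have hω : freq a n ≠ 0 := by
    unfold freq
    have : (n : ℝ) ≠ 0 := by exact_mod_cast hn
    positivity
  have h := norm_deriv_digamma_le (w := w) (by rw [hre]; norm_num) (by rw [him]; exact div_ne_zero hω two_ne_zero)
  have h1 : 1 / ‖w‖ ^ 2 ≤ 16 := by
    have hn2 : 1 / 16 ≤ ‖w‖ ^ 2 := by
      rw [Complex.sq_norm, Complex.normSq_apply, hre]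
      nlinarith [sq_nonneg w.im]
    rw [div_le_iff₀ (by positivity)]
    linarith
  have h2 : π / (2 * |w.im|) ≤ a := by
    rw [him, abs_div, abs_of_pos (by norm_num : (0 : ℝ) < 2)]
    have hfa : π / a ≤ |freq a n| := by
      unfold freq
      rw [abs_div, abs_mul, abs_of_pos Real.pi_pos, abs_of_pos ha]
      refine div_le_div_of_nonneg_right ?_ ha.le
      have : (1 : ℝ) ≤ |(n : ℝ)| := by
        rw [← Int.cast_abs]
        exact_mod_cast Int.one_le_abs hn
      nlinarith [Real.pi_pos]
    rw [div_le_iff₀ (by positivity)]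
    calc π = a * (π / a) := by field_simp
      _ ≤ a * |freq a n| := mul_le_mul_of_nonneg_left hfa ha.le
      _ = a * (2 * (|freq a n| / 2)) := by ring
  have := Complex.abs_re_le_norm (deriv Complex.digamma w)
  linarith

/-- `log(1 + c·x) ≤ log(1 + c) + log(1 + x)` for `c, x ≥ 0`. -/
theorem log_one_add_mul_le {c x : ℝ} (hc : 0 ≤ c) (hx : 0 ≤ x) :
    Real.log (1 + c * x) ≤ Real.log (1 + c) + Real.log (1 + x) := by
  rw [← Real.log_mul (by positivity) (by positivity)]
  refine Real.log_le_log (by positivity) ?_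
  nlinarith [mul_nonneg hc hx]

/-- **`|Re ψ(¼ + iω_n/2)| ≤ C + log(1 + |n|)`** with `C = C(a)` (`exists_norm_digamma_vertical_le` on `Re w = ¼`). -/
theorem exists_abs_reDigammaQuarter_freq_le (ha : 0 < a) :
    ∃ C : ℝ, 0 ≤ C ∧ ∀ n : ℤ, |reDigammaQuarter (freq a n)| ≤ C + Real.log (1 + |(n : ℝ)|) := by
  obtain ⟨C, hC⟩ := exists_norm_digamma_vertical_le (a := (1 / 4 : ℝ)) (by norm_num)
  have hC0 : 0 ≤ C := by
    have h := hC 0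
    simp only [abs_zero, add_zero, Real.log_one] at h
    exact (norm_nonneg _).trans h
  have hlog0 : 0 ≤ Real.log (1 + π / (2 * a)) := Real.log_nonneg (by
    have : 0 ≤ π / (2 * a) := by positivity
    linarith)
  refine ⟨C + Real.log (1 + π / (2 * a)), add_nonneg hC0 hlog0, fun n ↦ ?_⟩
  have h := hC (freq a n / 2)
  have e : ((1 / 4 : ℝ) : ℂ) + ((freq a n / 2 : ℝ) : ℂ) * I = 1 / 4 + ((freq a n : ℝ) : ℂ) / 2 * I := by
    push_cast; ring
  rw [e] at h
  have h1 : |reDigammaQuarter (freq a n)| ≤ C + Real.log (1 + |freq a n / 2|) := by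
    unfold reDigammaQuarter
    exact (Complex.abs_re_le_norm _).trans h
  have h2 : Real.log (1 + |freq a n / 2|) ≤ Real.log (1 + π / (2 * a)) + Real.log (1 + |(n : ℝ)|) := by
    have e2 : |freq a n / 2| = π / (2 * a) * |(n : ℝ)| := by
      unfold freq
      rw [abs_div, abs_div, abs_mul, abs_of_pos Real.pi_pos, abs_of_pos ha, abs_of_pos (by norm_num : (0 : ℝ) < 2)]
      ring
    rw [e2]
    exact log_one_add_mul_le (by positivity) (abs_nonneg _)
  linarith

/-- **Archimedean envelope on the diagonal**: `∃ C = C(a) ≥ 0`, `|ARCH(n,n)| ≤ C + log(1 + |n|)` for all `n`. -/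
theorem exists_abs_archCoeff_diag_le (ha : 0 < a) :
    ∃ C : ℝ, 0 ≤ C ∧ ∀ n : ℤ, |archCoeff a n n| ≤ C + Real.log (1 + |(n : ℝ)|) := by
  obtain ⟨Cψ, hCψ0, hCψ⟩ := exists_abs_reDigammaQuarter_freq_le ha
  set T : ℝ := 16 + a + ‖deriv Complex.digamma (1 / 4 + ((freq a 0 : ℝ) : ℂ) / 2 * I)‖ with hT
  set D : ℝ := 4 * Real.exp (-a) + Real.exp (-(5 * a)) / (1 - Real.exp (-(4 * a))) with hD
  have hq : 0 < 1 - Real.exp (-(4 * a)) := by linarith [exp_neg_four_mul_lt_one ha]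
  have hT0 : 0 ≤ T := by positivity
  have hD0 : 0 ≤ D := by positivity
  refine ⟨Cψ + |Real.log π| + T / (4 * a) + D / a,
    add_nonneg (add_nonneg (add_nonneg hCψ0 (abs_nonneg _)) (by positivity)) (by positivity), fun n ↦ ?_⟩
  have h1 := hCψ n
  have h2 := abs_re_deriv_digamma_freq_le ha n
  have h3 := abs_archExpSumDiag_le' ha n
  unfold archCoeff
  rw [if_pos rfl]
  have e1 : |(deriv Complex.digamma (1 / 4 + ((freq a n : ℝ) : ℂ) / 2 * I)).re / (4 * a)|
      ≤ T / (4 * a) := by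
    rw [abs_div, abs_of_pos (by positivity : (0 : ℝ) < 4 * a)]
    exact div_le_div_of_nonneg_right h2 (by positivity)
  have e2 : |archExpSumDiag a n / a| ≤ D / a := by
    rw [abs_div, abs_of_pos ha]
    exact div_le_div_of_nonneg_right h3 ha.le
  have t1 := abs_sub (reDigammaQuarter (freq a n) - Real.log π +
    (deriv Complex.digamma (1 / 4 + ((freq a n : ℝ) : ℂ) / 2 * I)).re / (4 * a)) (archExpSumDiag a n / a)
  have t2 := abs_add_le (reDigammaQuarter (freq a n) - Real.log π)
    ((deriv Complex.digamma (1 / 4 + ((freq a n : ℝ) : ℂ) / 2 * I)).re / (4 * a))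
  have t3 := abs_sub (reDigammaQuarter (freq a n)) (Real.log π)
  linarith

end Summit.RiemannHypothesis.RiemannHypothesis.Theorems.WeilFormatC

end
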